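import Mathlib.Algebra.BigOperators.Fin
import Mathlib.Algebra.BigOperators.Ring.Finset
import Mathlib.Data.Fintype.BigOperators
import Mathlib.Data.Real.Basic
import Mathlib.Logic.Equiv.Fin.Basic
import Mathlib.Tactic
import HarnessLib

/-!
# DAG node N07 [B11], the (P)_D located-research thread (road R0′ junction `hker`; INERT under road (a)):
# CENTRE-DEFECT TELESCOPING — the exact one-step splitting of the centre-minus-mean defect of a cube over its sub-cubes
# (the backbone of the SCALE-WISE decomposition `K = K₀ − Σ_i S_i^Ω` of ROAD-L4-V3 §3b)

Cell `pub-ymgap` (HUMAN RULINGS D-0062 ∕ D-0149 ∕ D-0154), width seat `pub-ymgap-dag-n07-w7` g7, CLAIM-3 (cell bus 2026-08-28).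
`--kind proof --supports stmt-QuantumFields-27364 --as helper` (K1⁹ per dag-lead KEY MAP v2; count-neutral).  THEOREMS ONLY (no `def`).

WHY (ROAD-L4-V3 §3b, dag-n07-w7 g7).  For a nested-cube tiling the centre form differs from the matched form by `Σ_B β_B D_B(Δ⁻²f)`,
`D_B(w) = Σ_{y∈B} w(y) − |B|·w(c_B)`.  Splitting a tile of side `m·n` into its `m^d` sub-cubes of side `n` (sub-centres `c_q`) gives EXACTLY
`D_B(w) = Σ_q D_{b_q}(w) + n^d·Σ_q (w(c_q) − w(c_B))` — the inner defects plus the defect of `w` SAMPLED on the sub-centre lattice; iterating over the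
levels `i < j` of a Bałaban tile (side `L^j`) yields `K − K₀ = −Σ_i S_i^Ω` with `S_i^Ω` the scale-`i` step functional (§3b: numerically each step's
diagonal part is signed, (SW-1), and dominates its cross part up to a few % of `K₀`, (SW-2)).  This file types the splitting on the index cube
`Fin d → Fin (m·n)` with sites `y_κ = t_κ + n·q_κ` (`finProdFinEquiv (q_κ, t_κ)`), for ARBITRARY reference points (the geometric choice «`c` = centre,
`c_q` = sub-centre» is the consumer's instantiation; nothing here depends on it):
* §1 `sum_cube_split` — `Σ_{y : Fin d → Fin (m·n)} F y = Σ_{q : Fin d → Fin m} Σ_{t : Fin d → Fin n} F (t + n·q)` (the block∕inner re-indexing, via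
  `Equiv.arrowProdEquivProdArrow` + `finProdFinEquiv`); `card` bookkeeping.
* §2 ★★ `centreDefect_split` — `Σ_y (w y − w c) = Σ_q Σ_t (w(t + n·q) − w(c_q)) + Σ_q n^d·(w(c_q) − w c)` for every `w`, `c`, `c_q`;
  ★ `centreDefect_split_weighted` — the same paired with block-constant coefficients `β`: `Σ_q β_q·(…)` form used by `S_i^Ω`;
  `centreDefect_split_twice` — two partition steps (side `m₁·(m₂·n)`), the shape of the full telescoping.

HONEST FRAMING (binding).  Count-neutral helper; [folklore] finite-sum re-indexing; asserts NOTHING of [B11]∕[B6]∕[B5]∕[3]; (SW-1)∕(SW-2) are located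
CONJECTURES (d = 1 numerics), not typed; `(P)_D` for Bałaban's `d = 4` nested geometries OPEN; under road (a) nothing here is consumed; `hker` ∕ stub 1 ∕ K0⁷ ∕ K1⁹
NOT closed; N07 NOT discharged; counts unmoved; no summit statement is proved by this seat — R4 closes the conditional finite-𝕋⁴ rung `BalabanLadder.UV` only;
nothing continuum ∕ ℝ⁴ ∕ OS ∕ mass gap ∕ Clay.  Context only: T. Bałaban, CMP **109** (1987) 249–301 [Balaban1987RG1] (0.4) (averaging at block centres, odd `L`).
-/

set_option autoImplicit false

noncomputable section

open Finset

namespace Summit.QuantumFields.YangMills.Theorems.N07CentreDefectTelescoping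

variable {d : ℕ}

/-! ## §1  Block ∕ inner re-indexing of the index cube `Fin d → Fin (m·n)` -/

/-- ★ **Block∕inner re-indexing**: `Σ_{y : Fin d → Fin (m·n)} F y = Σ_{q : Fin d → Fin m} Σ_{t : Fin d → Fin n} F (κ ↦ finProdFinEquiv (q κ, t κ))`
(site `y_κ = t_κ + n·q_κ`: `q` = sub-cube index, `t` = position inside the sub-cube). [folklore] -/
theorem sum_cube_split (m n : ℕ) (F : (Fin d → Fin (m * n)) → ℝ) :
    ∑ y : Fin d → Fin (m * n), F y
      = ∑ q : Fin d → Fin m, ∑ t : Fin d → Fin n, F (fun κ => finProdFinEquiv (q κ, t κ)) := by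
  let e : ((Fin d → Fin m) × (Fin d → Fin n)) ≃ (Fin d → Fin (m * n)) :=
    (Equiv.arrowProdEquivProdArrow (Fin d) (fun _ => Fin m) (fun _ => Fin n)).symm.trans
      (Equiv.piCongrRight fun _ => finProdFinEquiv)
  rw [← Fintype.sum_equiv e (fun p => F (e p)) F (fun _ => rfl), Fintype.sum_prod_type]
  rfl

/-- The site map is explicit: `(finProdFinEquiv (q κ, t κ) : ℕ) = t κ + n·q κ`. [folklore] -/
theorem site_val (m n : ℕ) (q : Fin d → Fin m) (t : Fin d → Fin n) (κ : Fin d) :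
    ((finProdFinEquiv (q κ, t κ) : Fin (m * n)) : ℕ) = (t κ : ℕ) + n * (q κ : ℕ) := by
  simp [finProdFinEquiv]

/-- `Σ_{y : Fin d → Fin k} 1 = k^d` (real). [folklore] -/
theorem sum_cube_const (k : ℕ) (a : ℝ) : ∑ _y : Fin d → Fin k, a = (k : ℝ) ^ d * a := by
  simp [Finset.sum_const, Finset.card_univ, Fintype.card_fin]

/-! ## §2  The one-step splitting of the centre-minus-mean defect -/

/-- ★★ **ONE-STEP SPLITTING OF THE CENTRE DEFECT** (every `w`, every reference point `c`, every family of sub-cube reference points `cq`):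
`Σ_y (w y − w c) = Σ_q Σ_t (w(site q t) − w(cq q)) + Σ_q n^d·(w(cq q) − w c)` — the defect of the big cube about `c` is the sum of the sub-cubes'
defects about their own points plus `n^d` times the defect of `w` SAMPLED on the sub-cube points about `c`. [folklore] -/
theorem centreDefect_split (m n : ℕ) (w : (Fin d → Fin (m * n)) → ℝ) (c : Fin d → Fin (m * n))
    (cq : (Fin d → Fin m) → (Fin d → Fin (m * n))) :
    ∑ y : Fin d → Fin (m * n), (w y - w c)
      = (∑ q : Fin d → Fin m, ∑ t : Fin d → Fin n, (w (fun κ => finProdFinEquiv (q κ, t κ)) - w (cq q)))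
        + ∑ q : Fin d → Fin m, (n : ℝ) ^ d * (w (cq q) - w c) := by
  rw [sum_cube_split m n (fun y => w y - w c), ← Finset.sum_add_distrib]
  refine Finset.sum_congr rfl fun q _ => ?_
  have h1 : ∑ t : Fin d → Fin n, (w (fun κ => finProdFinEquiv (q κ, t κ)) - w c)
      = ∑ t : Fin d → Fin n, (w (fun κ => finProdFinEquiv (q κ, t κ)) - w (cq q))
        + ∑ _t : Fin d → Fin n, (w (cq q) - w c) := by
    rw [← Finset.sum_add_distrib]
    exact Finset.sum_congr rfl fun t _ => by ring
  rw [h1, sum_cube_const]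

/-- ★ **Weighted edition** (the shape of the step functional `S_i^Ω`): for block coefficients `β q`,
`Σ_q β_q·Σ_t (w(site q t) − w c) = Σ_q β_q·Σ_t (w(site q t) − w(cq q)) + Σ_q β_q·n^d·(w(cq q) − w c)`. [folklore] -/
theorem centreDefect_split_weighted (m n : ℕ) (w : (Fin d → Fin (m * n)) → ℝ) (c : Fin d → Fin (m * n))
    (cq : (Fin d → Fin m) → (Fin d → Fin (m * n))) (β : (Fin d → Fin m) → ℝ) :
    ∑ q : Fin d → Fin m, β q * ∑ t : Fin d → Fin n, (w (fun κ => finProdFinEquiv (q κ, t κ)) - w c)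
      = (∑ q : Fin d → Fin m, β q * ∑ t : Fin d → Fin n, (w (fun κ => finProdFinEquiv (q κ, t κ)) - w (cq q)))
        + ∑ q : Fin d → Fin m, β q * ((n : ℝ) ^ d * (w (cq q) - w c)) := by
  rw [← Finset.sum_add_distrib]
  refine Finset.sum_congr rfl fun q _ => ?_
  rw [← mul_add]
  congr 1
  have h1 : ∑ t : Fin d → Fin n, (w (fun κ => finProdFinEquiv (q κ, t κ)) - w c)
      = ∑ t : Fin d → Fin n, (w (fun κ => finProdFinEquiv (q κ, t κ)) - w (cq q))
        + ∑ _t : Fin d → Fin n, (w (cq q) - w c) := by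
    rw [← Finset.sum_add_distrib]
    exact Finset.sum_congr rfl fun t _ => by ring
  rw [h1, sum_cube_const]

/-- The sampled defect of the middle level as a stand-alone quantity: `Σ_q n^d (w(cq q) − w c) = n^d·Σ_q (w(cq q) − w c)`. [folklore] -/
theorem sum_sampled_defect (m n : ℕ) (w : (Fin d → Fin (m * n)) → ℝ) (c : Fin d → Fin (m * n))
    (cq : (Fin d → Fin m) → (Fin d → Fin (m * n))) :
    ∑ q : Fin d → Fin m, (n : ℝ) ^ d * (w (cq q) - w c) = (n : ℝ) ^ d * ∑ q : Fin d → Fin m, (w (cq q) - w c) := by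
  rw [Finset.mul_sum]

/-- **Two partition steps** (side `m₁·(m₂·n)`): the defect about `c` splits into the `m₁^d·m₂^d` innermost defects, `n^d` times the middle sampled
defects, and `(m₂·n)^d` times the outer sampled defect — the shape of the full telescoping over the levels of a Bałaban tile. [folklore] -/
theorem centreDefect_split_twice (m₁ m₂ n : ℕ) (w : (Fin d → Fin (m₁ * (m₂ * n))) → ℝ) (c : Fin d → Fin (m₁ * (m₂ * n)))
    (c₁ : (Fin d → Fin m₁) → (Fin d → Fin (m₁ * (m₂ * n))))
    (c₂ : (Fin d → Fin m₁) → (Fin d → Fin m₂) → (Fin d → Fin (m₁ * (m₂ * n)))) :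
    ∑ y : Fin d → Fin (m₁ * (m₂ * n)), (w y - w c)
      = (∑ q₁ : Fin d → Fin m₁, ∑ q₂ : Fin d → Fin m₂, ∑ t : Fin d → Fin n,
            (w (fun κ => finProdFinEquiv (q₁ κ, finProdFinEquiv (q₂ κ, t κ))) - w (c₂ q₁ q₂)))
        + (∑ q₁ : Fin d → Fin m₁, ∑ q₂ : Fin d → Fin m₂, (n : ℝ) ^ d * (w (c₂ q₁ q₂) - w (c₁ q₁)))
        + ∑ q₁ : Fin d → Fin m₁, ((m₂ * n : ℕ) : ℝ) ^ d * (w (c₁ q₁) - w c) := by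
  rw [centreDefect_split m₁ (m₂ * n) w c c₁]
  have hinner : ∀ q₁ : Fin d → Fin m₁,
      ∑ t : Fin d → Fin (m₂ * n), (w (fun κ => finProdFinEquiv (q₁ κ, t κ)) - w (c₁ q₁))
        = (∑ q₂ : Fin d → Fin m₂, ∑ t : Fin d → Fin n,
              (w (fun κ => finProdFinEquiv (q₁ κ, finProdFinEquiv (q₂ κ, t κ))) - w (c₂ q₁ q₂)))
          + ∑ q₂ : Fin d → Fin m₂, (n : ℝ) ^ d * (w (c₂ q₁ q₂) - w (c₁ q₁)) := by
    intro q₁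
    rw [sum_cube_split m₂ n (fun s => w (fun κ => finProdFinEquiv (q₁ κ, s κ)) - w (c₁ q₁)), ← Finset.sum_add_distrib]
    refine Finset.sum_congr rfl fun q₂ _ => ?_
    have h1 : ∑ t : Fin d → Fin n, (w (fun κ => finProdFinEquiv (q₁ κ, finProdFinEquiv (q₂ κ, t κ))) - w (c₁ q₁))
        = ∑ t : Fin d → Fin n, (w (fun κ => finProdFinEquiv (q₁ κ, finProdFinEquiv (q₂ κ, t κ))) - w (c₂ q₁ q₂))
          + ∑ _t : Fin d → Fin n, (w (c₂ q₁ q₂) - w (c₁ q₁)) := by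
      rw [← Finset.sum_add_distrib]
      exact Finset.sum_congr rfl fun t _ => by ring
    rw [h1, sum_cube_const]
  simp only [hinner, Finset.sum_add_distrib]

end Summit.QuantumFields.YangMills.Theorems.N07CentreDefectTelescoping

end
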